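import Mathlib

/-!
# A2Denominators — the Conclusion of Prop. A4.2.4 (clearing denominators)

route/T4-A2-p6.md (cell pub-hodge-repro2, Tier 4, sub-claim A2), Prop. A4.2.4, Conclusion: «For a rational
class `E ∈ H^2(X, ℚ) ∩ H^{1,1}(X)`, some positive multiple `NE` lies in `H^2(X, ℤ)`
(`H^2(X, ℚ) = H^2(X, ℤ) ⊗ ℚ`) and is still of type `(1,1)`, so `E = (1/3N)(cl^X(D_1) − cl^X(D_2)) ∈ Alg^2(X)`.»

Kernel-checked here: `exists_nsmul_eq_one_tmul` — every element of `ℚ ⊗_ℤ M` (`M` any abelian group) has a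
positive integer multiple of the form `1 ⊗ m`, `m ∈ M`; and `mem_of_smul_sub_mem`: if `3N · E` is the
difference of two elements of a `ℚ`-subspace `A` (`3N ≠ 0`), then `E ∈ A`. The type-`(1,1)` clause is the
stability of `H^{1,1}` under scalars and is not restated.
-/

namespace Summit.Ventures.HodgeRepro2.A2Denominators

open TensorProduct

/-- Every element of `ℚ ⊗_ℤ M` has a positive integer multiple of the form `1 ⊗ m`: «some positive
multiple `NE` lies in `H^2(X, ℤ)`». -/
theorem exists_nsmul_eq_one_tmul {M : Type*} [AddCommGroup M] (x : ℚ ⊗[ℤ] M) :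
    ∃ n : ℕ, 0 < n ∧ ∃ m : M, n • x = (1 : ℚ) ⊗ₜ[ℤ] m := by
  induction x using TensorProduct.induction_on with
  | zero => exact ⟨1, Nat.one_pos, 0, by simp⟩
  | tmul q m =>
    refine ⟨q.den, q.den_pos, q.num • m, ?_⟩
    rw [← TensorProduct.smul_tmul, TensorProduct.smul_tmul']
    congr 1
    rw [nsmul_eq_mul, zsmul_eq_mul, mul_one]
    exact_mod_cast Rat.den_mul_eq_num q
  | add x y hx hy =>
    obtain ⟨n₁, hn₁, m₁, h₁⟩ := hx
    obtain ⟨n₂, hn₂, m₂, h₂⟩ := hy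
    refine ⟨n₁ * n₂, Nat.mul_pos hn₁ hn₂, n₂ • m₁ + n₁ • m₂, ?_⟩
    have e1 : (n₁ * n₂) • x = (1 : ℚ) ⊗ₜ[ℤ] (n₂ • m₁) := by
      rw [mul_comm, mul_smul, h₁, TensorProduct.tmul_smul]
    have e2 : (n₁ * n₂) • y = (1 : ℚ) ⊗ₜ[ℤ] (n₁ • m₂) := by
      rw [mul_smul, h₂, TensorProduct.tmul_smul]
    rw [smul_add, e1, e2, TensorProduct.tmul_add]

/-- «`E = (1/3N)(cl^X(D_1) − cl^X(D_2)) ∈ Alg^2(X)`»: if a non-zero integer multiple `k • E` is the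
difference of two elements of a `ℚ`-subspace `A`, then `E ∈ A`. -/
theorem mem_of_smul_sub_mem {V : Type*} [AddCommGroup V] [Module ℚ V] (A : Submodule ℚ V)
    {E a b : V} (ha : a ∈ A) (hb : b ∈ A) {k : ℕ} (hk : k ≠ 0) (h : (k : ℚ) • E = a - b) :
    E ∈ A := by
  have hk' : (k : ℚ) ≠ 0 := Nat.cast_ne_zero.2 hk
  have : E = (k : ℚ)⁻¹ • (a - b) := by
    rw [← h, smul_smul, inv_mul_cancel₀ hk', one_smul]
  rw [this]
  exact A.smul_mem _ (A.sub_mem ha hb)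

end Summit.Ventures.HodgeRepro2.A2Denominators
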